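import Literature.Analysis.FluidPDE.NSHopfLimit
import Summits.AnomalousDissipation.AnomalousDissipation.Theorems.CubicParityLoud.Negative.Clauses
import HarnessLib

/-!
# Stub S8 `stub_initialStrong` of the line `enstrophy-ui-transfer` for the crux
# `MomentParity.ResolvedDissipation` (stmt-AnomalousDissipation-14284)

Rellich on the Fourier side: if `L²` fields `v j` on `𝕋³` with UNIFORMLY bounded spectral enstrophy
`‖∇v j‖² ≤ G < ∞` converge coefficientwise to an `L²` field `w`, then `v j → w` strongly in `L²`.

Proof (Robinson–Rodrigo–Sadowski 2016, proof of Thm. 4.11; Hopf 1951, §4):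
* `‖∇w‖² ≤ liminf ‖∇v j‖² ≤ G` (`eGradNormSq_le_liminf_of_tendsto_mFourierCoeff`, Fatou for the series);
* split at frequency `K` (`Torus.lintegral_enorm_sub_sq_le_sum_add`): the finitely many low modes
  converge, the tail is `≤ (2/(4π²K²))·(G + G)`, small for `K` large, so `∫⁻ ‖v j - w‖ₑ² → 0`;
* `‖v j - w‖_{L²}` is the square root of that `lintegral`.

Supports stmt-AnomalousDissipation-14284 (helper file; closes nothing).
-/

noncomputable section

set_option linter.dupNamespace false

namespace Summit.AnomalousDissipation.AnomalousDissipation.Theorems.MomentParityResolvedDissipation.InitialStrong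

open MeasureTheory Filter Topology Set
open scoped ENNReal InnerProductSpace RealInnerProductSpace
open Literature.Analysis.FunctionSpaces Literature.Analysis.FluidPDE
open Summit.AnomalousDissipation.AnomalousDissipation.Theorems.CubicParityLoud.Negative (T3 R3)

/-- `‖f‖_{L²} = (∫⁻ ‖f‖ₑ²)^{1/2}` on `𝕋³`. -/
theorem eLpNorm_two_eq_lintegral_rpow_half (f : T3 → R3) :
    eLpNorm f 2 volume = (∫⁻ x, ‖f x‖ₑ ^ 2) ^ (1 / 2 : ℝ) := by
  rw [eLpNorm_eq_lintegral_rpow_enorm_toReal two_ne_zero ENNReal.ofNat_ne_top, ENNReal.toReal_ofNat]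
  congr 1
  refine lintegral_congr fun x => ?_
  rw [ENNReal.rpow_two]

/-- **The enstrophy bound passes to the coefficientwise limit**: `‖∇w‖² ≤ liminf ‖∇v j‖² ≤ G`
(Fatou for the series `4π² ∑ |k|² ‖·‖²`). -/
theorem eGradNormSq_limit_le (G : ℝ≥0∞) (v : ℕ → T3 → R3) (w : T3 → R3)
    (hZ : ∀ j, Torus.eGradNormSq (v j) ≤ G)
    (hcv : ∀ k, Filter.Tendsto (fun j => UnitAddTorus.mFourierCoeff (EuclideanSpace.complexify ∘ v j) k)
      Filter.atTop (𝓝 (UnitAddTorus.mFourierCoeff (EuclideanSpace.complexify ∘ w) k))) :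
    Torus.eGradNormSq w ≤ G := by
  have h : Torus.eGradNormSq w ≤ liminf (fun j => Torus.eGradNormSq (v j)) atTop :=
    eGradNormSq_le_liminf_of_tendsto_mFourierCoeff (U := fun j (_ : ℝ) => v j) (u := fun _ => w)
      (fun _ _ k => hcv k) le_rfl
  exact h.trans (liminf_le_of_frequently_le' (Eventually.of_forall hZ).frequently)

/-- **The tail constant vanishes**: `(2/(4π²K²))·(G + G) → 0` as `K → ∞` (`G < ∞`). -/
theorem tendsto_tail_const (G : ℝ≥0∞) (hG : G ≠ ⊤) :
    Filter.Tendsto (fun K : ℕ => ENNReal.ofReal (2 / (4 * Real.pi ^ 2 * (K : ℝ) ^ 2)) * (G + G))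
      Filter.atTop (𝓝 0) := by
  have hden : Tendsto (fun K : ℕ => 4 * Real.pi ^ 2 * (K : ℝ) ^ 2) atTop atTop :=
    Tendsto.const_mul_atTop (by positivity)
      ((tendsto_pow_atTop two_ne_zero).comp tendsto_natCast_atTop_atTop)
  have hr : Tendsto (fun K : ℕ => 2 / (4 * Real.pi ^ 2 * (K : ℝ) ^ 2)) atTop (𝓝 0) :=
    tendsto_const_nhds.div_atTop hden
  have h1 : Tendsto (fun K : ℕ => ENNReal.ofReal (2 / (4 * Real.pi ^ 2 * (K : ℝ) ^ 2))) atTop (𝓝 0) := by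
    simpa using ENNReal.tendsto_ofReal hr
  simpa using ENNReal.Tendsto.mul_const h1 (Or.inr (ENNReal.add_ne_top.2 ⟨hG, hG⟩))

/-- **The low modes converge**: for every frequency level `K`,
`∑_{|k| ≤ K} ‖v̂ j k - ŵ k‖ₑ² → 0` as `j → ∞`. -/
theorem tendsto_lowModes (v : ℕ → T3 → R3) (w : T3 → R3)
    (hcv : ∀ k, Filter.Tendsto (fun j => UnitAddTorus.mFourierCoeff (EuclideanSpace.complexify ∘ v j) k)
      Filter.atTop (𝓝 (UnitAddTorus.mFourierCoeff (EuclideanSpace.complexify ∘ w) k))) (K : ℕ) :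
    Filter.Tendsto (fun j => ∑ k ∈ Torus.freqBall K,
      ‖UnitAddTorus.mFourierCoeff (EuclideanSpace.complexify ∘ v j) k -
        UnitAddTorus.mFourierCoeff (EuclideanSpace.complexify ∘ w) k‖ₑ ^ 2) Filter.atTop (𝓝 0) := by
  have h0 : (0 : ℝ≥0∞) = ∑ k ∈ Torus.freqBall (d := Fin 3) K, (0 : ℝ≥0∞) := by simp
  rw [h0]
  refine tendsto_finsetSum _ fun k _ => ?_
  have h1 : Tendsto (fun j => UnitAddTorus.mFourierCoeff (EuclideanSpace.complexify ∘ v j) k -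
      UnitAddTorus.mFourierCoeff (EuclideanSpace.complexify ∘ w) k) atTop (𝓝 0) := by
    simpa using (hcv k).sub_const (UnitAddTorus.mFourierCoeff (EuclideanSpace.complexify ∘ w) k)
  have h2 : Tendsto (fun j => ‖UnitAddTorus.mFourierCoeff (EuclideanSpace.complexify ∘ v j) k -
      UnitAddTorus.mFourierCoeff (EuclideanSpace.complexify ∘ w) k‖ₑ ^ 2) atTop
      (𝓝 (‖(0 : EuclideanSpace ℂ (Fin 3))‖ₑ ^ 2)) :=
    ((ENNReal.continuous_pow 2).tendsto _).comp h1.enorm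
  simpa using h2

/-- **Strong convergence of the squared `L²` distance**: `∫⁻ ‖v j - w‖ₑ² → 0` (split at frequency
`K`, low modes converge, tail `≤ (2/(4π²K²))·(G + G)`). -/
theorem tendsto_lintegral_enorm_sub_sq (G : ℝ≥0∞) (hG : G ≠ ⊤) (v : ℕ → T3 → R3) (w : T3 → R3)
    (hv : ∀ j, MemLp (v j) 2 volume) (hw : MemLp w 2 volume)
    (hZ : ∀ j, Torus.eGradNormSq (v j) ≤ G)
    (hcv : ∀ k, Filter.Tendsto (fun j => UnitAddTorus.mFourierCoeff (EuclideanSpace.complexify ∘ v j) k)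
      Filter.atTop (𝓝 (UnitAddTorus.mFourierCoeff (EuclideanSpace.complexify ∘ w) k))) :
    Filter.Tendsto (fun j => ∫⁻ x, ‖v j x - w x‖ₑ ^ 2) Filter.atTop (𝓝 0) := by
  have hGw : Torus.eGradNormSq w ≤ G := eGradNormSq_limit_le G v w hZ hcv
  rw [ENNReal.tendsto_nhds_zero]
  intro ε hε
  have hε2 : 0 < ε / 2 := ENNReal.half_pos hε.ne'
  obtain ⟨K, hK⟩ := eventually_atTop.1 (ENNReal.tendsto_nhds_zero.1 (tendsto_tail_const G hG) (ε / 2) hε2)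
  have hK1 : 1 ≤ max K 1 := le_max_right _ _
  have hKt : ENNReal.ofReal (2 / (4 * Real.pi ^ 2 * ((max K 1 : ℕ) : ℝ) ^ 2)) * (G + G) ≤ ε / 2 :=
    hK (max K 1) (le_max_left _ _)
  filter_upwards [ENNReal.tendsto_nhds_zero.1 (tendsto_lowModes v w hcv (max K 1)) (ε / 2) hε2] with j hj
  calc ∫⁻ x, ‖v j x - w x‖ₑ ^ 2
      ≤ (∑ k ∈ Torus.freqBall (max K 1),
          ‖UnitAddTorus.mFourierCoeff (EuclideanSpace.complexify ∘ v j) k -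
            UnitAddTorus.mFourierCoeff (EuclideanSpace.complexify ∘ w) k‖ₑ ^ 2) +
          ENNReal.ofReal (2 / (4 * Real.pi ^ 2 * ((max K 1 : ℕ) : ℝ) ^ 2)) *
            (Torus.eGradNormSq (v j) + Torus.eGradNormSq w) :=
        Torus.lintegral_enorm_sub_sq_le_sum_add (hv j) hw hK1
    _ ≤ ε / 2 + ENNReal.ofReal (2 / (4 * Real.pi ^ 2 * ((max K 1 : ℕ) : ℝ) ^ 2)) * (G + G) :=
        add_le_add hj (mul_le_mul_right (add_le_add (hZ j) hGw) _)
    _ ≤ ε / 2 + ε / 2 := add_le_add le_rfl hKt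
    _ = ε := ENNReal.add_halves ε

/-- **S8 · `stub_initialStrong` — Rellich on the Fourier side.** If `L²` fields `v j` with UNIFORMLY
bounded spectral enstrophy `‖∇v j‖² ≤ G < ∞` converge coefficientwise to an `L²` field `w`, then
`v j → w` strongly in `L²(𝕋³)`: `‖∇w‖² ≤ liminf ‖∇v j‖² ≤ G`
(`eGradNormSq_le_liminf_of_tendsto_mFourierCoeff`); split at frequency `K`
(`Torus.lintegral_enorm_sub_sq_le_sum_add`): the finitely many low modes converge, the tail is
`≤ (2/(4π²K²))·2G`, small for `K` large; `eLpNorm · 2` is the square root of that `lintegral`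
(Robinson–Rodrigo–Sadowski 2016, Thm. 4.11, proof). -/
theorem stub_initialStrong (G : ℝ≥0∞) (hG : G ≠ ⊤) (v : ℕ → T3 → R3) (w : T3 → R3)
    (hv : ∀ j, MemLp (v j) 2 volume) (hw : MemLp w 2 volume)
    (hZ : ∀ j, Torus.eGradNormSq (v j) ≤ G)
    (hcv : ∀ k, Filter.Tendsto (fun j => UnitAddTorus.mFourierCoeff (EuclideanSpace.complexify ∘ v j) k)
      Filter.atTop (𝓝 (UnitAddTorus.mFourierCoeff (EuclideanSpace.complexify ∘ w) k))) :
    Filter.Tendsto (fun j => eLpNorm (v j - w) 2 volume) Filter.atTop (𝓝 0) := by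
  have hsq := tendsto_lintegral_enorm_sub_sq G hG v w hv hw hZ hcv
  have h := ((ENNReal.continuous_rpow_const (y := 1 / 2)).tendsto 0).comp hsq
  rw [ENNReal.zero_rpow_of_pos (by norm_num)] at h
  refine h.congr fun j => ?_
  simp only [Function.comp_apply, eLpNorm_two_eq_lintegral_rpow_half, Pi.sub_apply]

end Summit.AnomalousDissipation.AnomalousDissipation.Theorems.MomentParityResolvedDissipation.InitialStrong
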